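import Summits.QuantumFields.QCD.Theorems.MassiveBody.Negative.MassBlind
import Summits.QuantumFields.QCD.Theorems.PauliWegnerSeaChiralGluonicCompletionDefs
import Literature.MathematicalPhysics.QuantumFieldTheory.QCDGoldstoneBound

/-!
# Crux `ChiralGluonicCompletion` (stmt-QuantumFields-17498) — why every line must subsequence:
# keep-`reg` completion forces MASS-BLIND continuum data (kernel-checked form of ideator 2's finding (A))

Line `Sketch`, lead c6 / line cycle 7 (2026-08-17).  The dead-line dossier (`Cruxes/ChiralGluonicCompletion/Lines/
Sketch-dead.md` §4) rests on one premise so far argued only informally (ideator 2 (A); `Sketch_ideator1_r1.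
SameRegChiralCompletion` "FALSE in general (interleaved witnesses)"; Disproof §3): a completion of the typed crux cannot
KEEP the hypothesis' regularisation, so it must subsequence — where the typed `∃ᶠ` pin is not inherited (stub E*,
p139008 / p142184 / p144745).  This file makes the premise precise, in the tree's vocabulary, without definitions,
re-using the period-two INTERLEAVING of a regularisation with its RGI up-shift by `M` built today for the sibling crux
`ChiralSpinWaves.MassiveBody` (`Theorems/MassiveBody/Negative/MassBlind.lean`): `a, β, L, Z_m` read at `⌊k/2⌋`,
`m_crit'(k) = m_crit(⌊k/2⌋) + (k mod 2)·a M/Z_m`, so even steps of `reg'` at masses `m` are steps of `reg` at `m`, odd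
steps those of `reg` at `m + M·1` (here as the equation hypothesis `hreg'`; its field equations feed that file's
`interleave_hasMassScaling/_hasAsymptoticScaling`, `latticeGap_along`, `isQCDAlong_along`).

**§1 `Hyp` is closed under interleaving, `M ≥ 0`** (`interleave_hyp`): clause (i), clause (iv) (at the interleaving's
own side `2L_{⌊k/2⌋}+1`) and the flavour-charged phase-quenched decay transfer from `reg` at `m` (even steps) and at
`m + M·1` (odd steps), gluing the two `∀ᶠ` clauses with `min` rates / `max` constants; clauses (ii)/(iii) likewise
PROVIDED the fractional-moment exponents `s₂, s₃` are mass-independent (moments at different `s` are different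
quantities; a mass-dependent `s(m)` would need Jensen on the phase-quenched expectations, not attempted — every
fractional-moment method delivers a fixed `s` anyway); and the PIN transfers for free: a gap violation of `reg` at step
`j` is one of `reg'` at step `2j` (`interleave_isChiralAtZero`) — no selection is needed in THIS direction.
**§2 `massBlind_of_sameRegCompletion`.**  If every `Hyp`-witness carried the matrix `Body` of `QCDOf` along ITSELF at
every positive tuple (keep-`reg`; it WOULD close the crux in one line, `chiralGluonicCompletion_of_sameRegCompletion`),
then every `Hyp`-witness `reg` with mass-independent exponents would have, for every `M ≥ 0` and positive `m`, ONE OS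
datum `T` (non-trivial non-Gaussian glue, flavour-changing pseudoscalars non-trivial, `T.HasMassGap Δ`) that is
`IsQCDAlong`-QCD along `reg` at the masses `m` AND at `m + M·1`, one common lattice gap `Δ > 0` at both.  Honest
continuum QCD is not mass-blind (hadron masses move with the quark mass; `z, shift` cannot reconcile two decay rates):
the typed hypothesis cannot tell `reg` from its interleaving, full-sequence convergence can — the precise content of
"keep-reg is dead by `m_crit`-interleaving".  Nothing is claimed about lattice QCD itself.
-/

noncomputable section

namespace Summit.QuantumFields.QCD.Theorems.StronglyChiralSubsequence

open MeasureTheory Filter Topology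
open scoped SchwartzMap
open Literature.MathematicalPhysics.QuantumFieldTheory Literature.MathematicalPhysics.QuantumLattice
  Literature.Probability.LatticeModels Literature.MathematicalPhysics.AQFT
open Summit.QuantumFields.QCD.Theorems.MassiveBody.Negative

variable {Nf : ℕ}

/-- Gluing two eventual properties of `j` into one of the interleaved index `k` (`⌊k/2⌋ = j`, `k mod 2` selects). -/
theorem eventually_glue {P Q : ℕ → Prop} (hP : ∀ᶠ j in atTop, P j) (hQ : ∀ᶠ j in atTop, Q j) :
    ∀ᶠ k in atTop, (k % 2 = 0 → P (k / 2)) ∧ (k % 2 = 1 → Q (k / 2)) :=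
  ((tendsto_atTop_mono (fun k : ℕ => show id k / 2 ≤ k / 2 from le_rfl)
    (Filter.map_div_atTop_eq_nat 2 two_pos).le).eventually (hP.and hQ)).mono
    fun _ hk => ⟨fun _ => hk.1, fun _ => hk.2⟩

/-- Weakening an upper bound `C e^{-δ x}` (`x ≥ 0`): larger (non-negative) constant, smaller rate. -/
theorem mul_exp_neg_mono {C C' δ δ' x : ℝ} (hC : C ≤ C') (hC' : 0 ≤ C') (hδ : δ' ≤ δ) (hx : 0 ≤ x) :
    C * Real.exp (-(δ * x)) ≤ C' * Real.exp (-(δ' * x)) :=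
  (mul_le_mul_of_nonneg_right hC (Real.exp_pos _).le).trans
    (mul_le_mul_of_nonneg_left (Real.exp_le_exp.2 (neg_le_neg (mul_le_mul_of_nonneg_right hδ hx))) hC')

/-- Weakening a lower bound `c e^{-(C x + p y)}` (`x, y ≥ 0`): smaller constant, larger rates. -/
theorem mul_exp_neg_add_anti {c c' C C' p p' x y : ℝ} (hc : c' ≤ c) (hc0 : 0 ≤ c) (hC : C ≤ C')
    (hp : p ≤ p') (hx : 0 ≤ x) (hy : 0 ≤ y) :
    c' * Real.exp (-(C' * x + p' * y)) ≤ c * Real.exp (-(C * x + p * y)) :=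
  (mul_le_mul_of_nonneg_right hc (Real.exp_pos _).le).trans
    (mul_le_mul_of_nonneg_left (Real.exp_le_exp.2 (neg_le_neg (add_le_add
      (mul_le_mul_of_nonneg_right hC hx) (mul_le_mul_of_nonneg_right hp hy)))) hc0)

/-- Even mass rewriting: at an even step the interleaving's bare masses at `m` are `reg`'s at `m` (step `⌊k/2⌋`). -/
theorem interleave_mass_even (reg : QCDRegularisation Nf) (M : ℝ) {k : ℕ} (hk : k % 2 = 0) (m : Fin Nf → ℝ)
    (fl : Fin Nf) :
    reg.mcrit (k / 2) + reg.a (k / 2) * (((k % 2 : ℕ) : ℝ) * M) / reg.Zm (k / 2) + reg.a (k / 2) * m fl / reg.Zm (k / 2) =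
      reg.mcrit (k / 2) + reg.a (k / 2) * m fl / reg.Zm (k / 2) := by
  rw [hk]; push_cast; ring

/-- Odd mass rewriting: at an odd step they are `reg`'s at `m + M·1` (step `⌊k/2⌋`). -/
theorem interleave_mass_odd (reg : QCDRegularisation Nf) (M : ℝ) {k : ℕ} (hk : k % 2 = 1) (m : Fin Nf → ℝ)
    (fl : Fin Nf) :
    reg.mcrit (k / 2) + reg.a (k / 2) * (((k % 2 : ℕ) : ℝ) * M) / reg.Zm (k / 2) + reg.a (k / 2) * m fl / reg.Zm (k / 2) =
      reg.mcrit (k / 2) + reg.a (k / 2) * (m fl + M) / reg.Zm (k / 2) := by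
  rw [hk]; push_cast; ring

/-! ## §1 `Hyp` passes to the interleaving of `reg` with its up-shift by `M ≥ 0` -/

section Interleave

variable (reg reg' : QCDRegularisation Nf) (M : ℝ)
  (hreg' : reg' =
    { a := fun k => reg.a (k / 2)
      a_pos := fun _ => reg.a_pos _
      tendsto_a := reg.tendsto_a.comp (Filter.map_div_atTop_eq_nat 2 two_pos).le
      β := fun k => reg.β (k / 2)
      L := fun k => reg.L (k / 2)
      tendsto_L := reg.tendsto_L.comp (Filter.map_div_atTop_eq_nat 2 two_pos).le
      mcrit := fun k => reg.mcrit (k / 2) + reg.a (k / 2) * (((k % 2 : ℕ) : ℝ) * M) / reg.Zm (k / 2)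
      Zm := fun k => reg.Zm (k / 2)
      Zm_pos := fun _ => reg.Zm_pos _ })

include hreg'

/-- Field equations of the interleaving (the hypotheses of `MassiveBody.Negative.interleave_*`): spacings. -/
theorem il_a : ∀ k, reg'.a k = reg.a (k / 2) := by subst hreg'; intro k; rfl
/-- … couplings. -/
theorem il_β : ∀ k, reg'.β k = reg.β (k / 2) := by subst hreg'; intro k; rfl
/-- … volumes. -/
theorem il_L : ∀ k, reg'.L k = reg.L (k / 2) := by subst hreg'; intro k; rfl
/-- … mass renormalisations. -/
theorem il_Zm : ∀ k, reg'.Zm k = reg.Zm (k / 2) := by subst hreg'; intro k; rfl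
/-- … critical masses (odd steps up-shifted by `a M / Z_m`). -/
theorem il_mcrit : ∀ k, reg'.mcrit k =
    reg.mcrit (k / 2) + reg.a (k / 2) * (((k % 2 : ℕ) : ℝ) * M) / reg.Zm (k / 2) := by
  subst hreg'; intro k; rfl

/-- **The pin passes to the interleaving**: a uniform gap of `reg'` at `m` would restrict, along the even steps, to
one of `reg` at `m` (`latticeGap_along`); so every gap violation of `reg` is inherited — no selection needed. -/
theorem interleave_isChiralAtZero (h : reg.IsChiralAtZero) : reg'.IsChiralAtZero := by
  intro ε hε
  obtain ⟨m, hm, hgap⟩ := h ε hε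
  refine ⟨m, hm, fun hg => hgap ?_⟩
  exact latticeGap_along (fun j => 2 * j) (fun j => by omega) hg
    (interleave_L_eq reg reg' (il_L reg reg' M hreg')).1 (interleave_β_eq reg reg' (il_β reg reg' M hreg')).1
    (interleave_a_eq reg reg' (il_a reg reg' M hreg')).1
    (interleave_mq_even reg reg' M (il_a reg reg' M hreg') (il_Zm reg reg' M hreg') (il_mcrit reg reg' M hreg') m 0 0 0 0)

/-- Clause (i) of the interleaving at `m` from clause (i) of `reg` at `m` and at `m + M·1`. -/
theorem interleave_clauseI (m : Fin Nf → ℝ) (h0 : ClauseI Nf reg m) (h1 : ClauseI Nf reg (fun f => m f + M)) :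
    ClauseI Nf reg' m := by
  subst hreg'
  intro f
  dsimp only [ClauseI] at h0 h1
  refine (eventually_glue (h0 f) (h1 f)).mono fun k hk => ?_
  show -1 < reg.mcrit (k / 2) + reg.a (k / 2) * (((k % 2 : ℕ) : ℝ) * M) / reg.Zm (k / 2) +
    reg.a (k / 2) * m f / reg.Zm (k / 2)
  rcases Nat.mod_two_eq_zero_or_one k with he | ho
  · rw [interleave_mass_even reg M he]; exact hk.1 he
  · rw [interleave_mass_odd reg M ho]; exact hk.2 ho

/-- **Clause (ii) of the interleaving** from (ii) of `reg` along the mass ray with mass-independent EXPONENT `s`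
(rates/constants may depend on the mass: glued with `min δ`, `max C`). -/
theorem interleave_clauseII (hM : 0 ≤ M) {s : ℝ} (hs : 0 < s) (hs1 : s < 1)
    (hU : ∀ m : Fin Nf → ℝ, (∀ f, 0 < m f) → ∃ δ C : ℝ, 0 < δ ∧ ∀ᶠ k in atTop, ∀ S : ℕ, reg.L k ≤ S → ∀ (f : Fin Nf) (v : Literature.Probability.LatticeModels.Site 4), v ∈ box 4 S → (∫ U : GaugeConfig 4 (2 * S + 1) (Matrix.specialUnitaryGroup (Fin 3) ℂ), ‖(diracMatrix U fun fl => reg.mcrit k + reg.a k * m fl / reg.Zm k).det‖ * (∑ a : Fin 3, ∑ i : Fin 4, ∑ b : Fin 3, ∑ j : Fin 4, ‖(diracMatrix U fun fl => reg.mcrit k + reg.a k * m fl / reg.Zm k)⁻¹ (quarkEquiv (f, (Torus.proj (2 * S + 1) 0, a, i))) (quarkEquiv (f, (Torus.proj (2 * S + 1) (v), b, j)))‖) ^ s ∂(wilsonMeasure (fundamentalRep (Fin 3)) (reg.β k))) / (∫ U : GaugeConfig 4 (2 * S + 1) (Matrix.specialUnitaryGroup (Fin 3) ℂ), ‖(diracMatrix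 U fun fl => reg.mcrit k + reg.a k * m fl / reg.Zm k).det‖ ∂(wilsonMeasure (fundamentalRep (Fin 3)) (reg.β k))) ≤ C * Real.exp (-(δ * (reg.a k * ‖v‖))))
    (m : Fin Nf → ℝ) (hm : ∀ f, 0 < m f) : ClauseII Nf reg' m := by
  obtain ⟨δ₀, C₀, hδ₀, h0⟩ := hU m hm
  obtain ⟨δ₁, C₁, hδ₁, h1⟩ := hU (fun f => m f + M) fun f => add_pos_of_pos_of_nonneg (hm f) hM
  subst hreg'
  refine ⟨s, min δ₀ δ₁, max (max C₀ C₁) 0, hs, hs1, lt_min hδ₀ hδ₁, ?_⟩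
  dsimp only
  refine (eventually_glue h0 h1).mono fun k hk S hS f v hv => ?_
  have hx : 0 ≤ reg.a (k / 2) * ‖v‖ := mul_nonneg (reg.a_pos _).le (norm_nonneg _)
  rcases Nat.mod_two_eq_zero_or_one k with he | ho
  · simp only [interleave_mass_even reg M he]
    exact ((hk.1 he) S hS f v hv).trans
      (mul_exp_neg_mono ((le_max_left C₀ C₁).trans (le_max_left _ _)) (le_max_right _ _) (min_le_left _ _) hx)
  · simp only [interleave_mass_odd reg M ho]
    exact ((hk.2 ho) S hS f v hv).trans
      (mul_exp_neg_mono ((le_max_right C₀ C₁).trans (le_max_left _ _)) (le_max_right _ _) (min_le_right _ _) hx)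

/-- **Clause (iii) of the interleaving** from (iii) of `reg` along the mass ray, mass-independent exponent `s`
(glued with `min c₀`, `max C₁`, `max p`). -/
theorem interleave_clauseIII (hM : 0 ≤ M) {s : ℝ} (hs : 0 < s) (hs1 : s < 1)
    (hU : ∀ m : Fin Nf → ℝ, (∀ f, 0 < m f) → ∃ c₀ C₁ p : ℝ, 0 < c₀ ∧ ∀ᶠ k in atTop, ∀ S : ℕ, reg.L k ≤ S → ∀ (f : Fin Nf) (n : ℕ), n ≤ S → c₀ * Real.exp (-(C₁ * (reg.a k * n) + p * Real.log (n + 1))) ≤ (∫ U : GaugeConfig 4 (2 * S + 1) (Matrix.specialUnitaryGroup (Fin 3) ℂ), ‖(diracMatrix U fun fl => reg.mcrit k + reg.a k * m fl / reg.Zm k).det‖ * (∑ a : Fin 3, ∑ i : Fin 4, ∑ b : Fin 3, ∑ j : Fin 4, ‖(diracMatrix U fun fl => reg.mcrit k + reg.a k * m fl / reg.Zm k)⁻¹ (quarkEquiv (f, (Torus.proj (2 * S + 1) 0, a, i))) (quarkEquiv (f, (Torus.proj (2 * S + 1) (Pi.single 0 (n : ℤ)), b, j)))‖) ^ s ∂(wilsonMeasure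 (fundamentalRep (Fin 3)) (reg.β k))) / (∫ U : GaugeConfig 4 (2 * S + 1) (Matrix.specialUnitaryGroup (Fin 3) ℂ), ‖(diracMatrix U fun fl => reg.mcrit k + reg.a k * m fl / reg.Zm k).det‖ ∂(wilsonMeasure (fundamentalRep (Fin 3)) (reg.β k))))
    (m : Fin Nf → ℝ) (hm : ∀ f, 0 < m f) : ClauseIII Nf reg' m := by
  obtain ⟨c₀, C₀, p₀, hc₀, h0⟩ := hU m hm
  obtain ⟨c₁, C₁, p₁, hc₁, h1⟩ := hU (fun f => m f + M) fun f => add_pos_of_pos_of_nonneg (hm f) hM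
  subst hreg'
  refine ⟨s, min c₀ c₁, max C₀ C₁, max p₀ p₁, hs, hs1, lt_min hc₀ hc₁, ?_⟩
  dsimp only
  refine (eventually_glue h0 h1).mono fun k hk S hS f n hn => ?_
  have hx : 0 ≤ reg.a (k / 2) * n := mul_nonneg (reg.a_pos _).le (Nat.cast_nonneg n)
  have hy : 0 ≤ Real.log (n + 1) := Real.log_nonneg (by simp)
  rcases Nat.mod_two_eq_zero_or_one k with he | ho
  · simp only [interleave_mass_even reg M he]
    exact (mul_exp_neg_add_anti (min_le_left _ _) hc₀.le (le_max_left _ _) (le_max_left _ _) hx hy).trans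
      ((hk.1 he) S hS f n hn)
  · simp only [interleave_mass_odd reg M ho]
    exact (mul_exp_neg_add_anti (min_le_right _ _) hc₁.le (le_max_right _ _) (le_max_right _ _) hx hy).trans
      ((hk.2 ho) S hS f n hn)

/-- Clause (iv) of the interleaving at `m` from (iv) of `reg` at `m` and at `m + M·1` (at its own side `2L_{⌊k/2⌋}+1`:
no volume is rewritten, the instance arguments agree by proof irrelevance). -/
theorem interleave_clauseIV (m : Fin Nf → ℝ) (h0 : ClauseIV Nf reg m) (h1 : ClauseIV Nf reg (fun f => m f + M)) :
    ClauseIV Nf reg' m := by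
  subst hreg'
  dsimp only [ClauseIV] at h0 h1 ⊢
  refine (eventually_glue h0 h1).mono fun k hk => ?_
  rcases Nat.mod_two_eq_zero_or_one k with he | ho
  · simp only [interleave_mass_even reg M he]
    exact hk.1 he
  · simp only [interleave_mass_odd reg M ho]
    exact hk.2 ho

/-- **PQFD of the interleaving at `m`** from PQFD of `reg` at `m` and at `m + M·1` (rate `min`, constant `max`). -/
theorem interleave_pqfd (m : Fin Nf → ℝ) (h0 : PQFD Nf reg m) (h1 : PQFD Nf reg (fun f => m f + M)) :
    PQFD Nf reg' m := by
  obtain ⟨δ₀, hδ₀, H0⟩ := h0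
  obtain ⟨δ₁, hδ₁, H1⟩ := h1
  subst hreg'
  refine ⟨min δ₀ δ₁, lt_min hδ₀ hδ₁, fun R R' A B hA => ?_⟩
  obtain ⟨C₀, hC₀⟩ := H0 R R' A B hA
  obtain ⟨C₁, hC₁⟩ := H1 R R' A B hA
  refine ⟨max (max C₀ C₁) 0, ?_⟩
  dsimp only at hC₁ ⊢
  refine (eventually_glue hC₀ hC₁).mono fun k hk S hS n hn => ?_
  have hx : 0 ≤ reg.a (k / 2) * n := mul_nonneg (reg.a_pos _).le (Nat.cast_nonneg n)
  rcases Nat.mod_two_eq_zero_or_one k with he | ho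
  · simp only [interleave_mass_even reg M he]
    exact ((hk.1 he) S hS n hn).trans
      (mul_exp_neg_mono ((le_max_left C₀ C₁).trans (le_max_left _ _)) (le_max_right _ _) (min_le_left _ _) hx)
  · simp only [interleave_mass_odd reg M ho]
    exact ((hk.2 ho) S hS n hn).trans
      (mul_exp_neg_mono ((le_max_right C₀ C₁).trans (le_max_left _ _)) (le_max_right _ _) (min_le_right _ _) hx)

/-- **`Hyp` is closed under interleaving with an up-shifted copy** (`M ≥ 0`), pin included, for witnesses whose
fractional-moment clauses (ii)/(iii) hold with mass-independent exponents `s₂, s₃`. -/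
theorem interleave_hyp (hH : Hyp Nf reg) (hM : 0 ≤ M) {s₂ s₃ : ℝ} (hs₂ : 0 < s₂ ∧ s₂ < 1) (hs₃ : 0 < s₃ ∧ s₃ < 1)
    (hU₂ : ∀ m : Fin Nf → ℝ, (∀ f, 0 < m f) → ∃ δ C : ℝ, 0 < δ ∧ ∀ᶠ k in atTop, ∀ S : ℕ, reg.L k ≤ S → ∀ (f : Fin Nf) (v : Literature.Probability.LatticeModels.Site 4), v ∈ box 4 S → (∫ U : GaugeConfig 4 (2 * S + 1) (Matrix.specialUnitaryGroup (Fin 3) ℂ), ‖(diracMatrix U fun fl => reg.mcrit k + reg.a k * m fl / reg.Zm k).det‖ * (∑ a : Fin 3, ∑ i : Fin 4, ∑ b : Fin 3, ∑ j : Fin 4, ‖(diracMatrix U fun fl => reg.mcrit k + reg.a k * m fl / reg.Zm k)⁻¹ (quarkEquiv (f, (Torus.proj (2 * S + 1) 0, a, i))) (quarkEquiv (f, (Torus.proj (2 * S + 1) (v), b, j)))‖) ^ s₂ ∂(wilsonMeasure (fundamentalRep (Fin 3)) (reg.β k))) / (∫ U : GaugeConfig 4 (2 * S + 1) (Matrix.specialUnitaryGroup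 (Fin 3) ℂ), ‖(diracMatrix U fun fl => reg.mcrit k + reg.a k * m fl / reg.Zm k).det‖ ∂(wilsonMeasure (fundamentalRep (Fin 3)) (reg.β k))) ≤ C * Real.exp (-(δ * (reg.a k * ‖v‖))))
    (hU₃ : ∀ m : Fin Nf → ℝ, (∀ f, 0 < m f) → ∃ c₀ C₁ p : ℝ, 0 < c₀ ∧ ∀ᶠ k in atTop, ∀ S : ℕ, reg.L k ≤ S → ∀ (f : Fin Nf) (n : ℕ), n ≤ S → c₀ * Real.exp (-(C₁ * (reg.a k * n) + p * Real.log (n + 1))) ≤ (∫ U : GaugeConfig 4 (2 * S + 1) (Matrix.specialUnitaryGroup (Fin 3) ℂ), ‖(diracMatrix U fun fl => reg.mcrit k + reg.a k * m fl / reg.Zm k).det‖ * (∑ a : Fin 3, ∑ i : Fin 4, ∑ b : Fin 3, ∑ j : Fin 4, ‖(diracMatrix U fun fl => reg.mcrit k + reg.a k * m fl / reg.Zm k)⁻¹ (quarkEquiv (f, (Torus.proj (2 * S + 1) 0, a, i))) (quarkEquiv (f, (Torus.proj (2 * S + 1) (Pi.single 0 (n : ℤ)), b, j)))‖) ^ s₃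 ∂(wilsonMeasure (fundamentalRep (Fin 3)) (reg.β k))) / (∫ U : GaugeConfig 4 (2 * S + 1) (Matrix.specialUnitaryGroup (Fin 3) ℂ), ‖(diracMatrix U fun fl => reg.mcrit k + reg.a k * m fl / reg.Zm k).det‖ ∂(wilsonMeasure (fundamentalRep (Fin 3)) (reg.β k)))) :
    Hyp Nf reg' := by
  obtain ⟨hMS, hCh, hAS, hper⟩ := hH
  refine ⟨interleave_hasMassScaling reg reg' (il_a reg reg' M hreg') (il_Zm reg reg' M hreg') hMS,
    interleave_isChiralAtZero reg reg' M hreg' hCh,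
    interleave_hasAsymptoticScaling reg reg' (il_a reg reg' M hreg') (il_β reg reg' M hreg') hAS, fun m hm => ?_⟩
  have hmM : ∀ f, 0 < m f + M := fun f => add_pos_of_pos_of_nonneg (hm f) hM
  obtain ⟨⟨hI, -, -, hIV⟩, hPQ⟩ := hper m hm
  obtain ⟨⟨hI', -, -, hIV'⟩, hPQ'⟩ := hper _ hmM
  exact ⟨⟨interleave_clauseI reg reg' M hreg' m hI hI', interleave_clauseII reg reg' M hreg' hM hs₂.1 hs₂.2 hU₂ m hm,
    interleave_clauseIII reg reg' M hreg' hM hs₃.1 hs₃.2 hU₃ m hm, interleave_clauseIV reg reg' M hreg' m hIV hIV'⟩,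
    interleave_pqfd reg reg' M hreg' m hPQ hPQ'⟩

/-- **… while its odd steps are a NON-chiral subsequence** as soon as `reg` is uniformly gapped above the shift `M`
(expected of every honest trajectory for `M > 0`): the odd steps run `reg` up-shifted by `M`, so a uniform lattice gap `ε` of `reg`
at all tuples `> M·1` is a uniform gap `ε` of the odd subsequence of `reg'` at EVERY positive tuple — the pin fails there.
So a `Hyp`-witness (`interleave_hyp`) may carry non-chiral subsequences in the tree's own vocabulary (the abstract
countermodels p142184 / p144745 say the same of the SHAPE of `Hyp`): a subsequencing completion must SELECT chirality. -/
theorem interleave_odd_not_isChiralAtZero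
    (hgap : ∃ ε > (0 : ℝ), ∀ m : Fin Nf → ℝ, (∀ f, M < m f) → (reg.scheme m 0 0).HasLatticeMassGap ε) :
    ¬ (reg'.restrict (fun j => 2 * j + 1)
        (tendsto_atTop_mono (fun j : ℕ => show id j ≤ 2 * j + 1 by simp only [id]; omega) tendsto_id)).IsChiralAtZero := by
  subst hreg'
  intro hch
  obtain ⟨ε, hε, hg⟩ := hgap
  obtain ⟨m, hm, hng⟩ := hch ε hε
  refine hng (latticeGap_along (sch := reg.scheme (fun f => m f + M) 0 0) id (fun _ => le_rfl)
    (hg _ fun f => by linarith [hm f]) (fun j => ?_) (fun j => ?_) (fun j => ?_) (fun j => ?_))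
  · show reg.L j = reg.L ((2 * j + 1) / 2)
    congr 1; omega
  · show reg.β j = reg.β ((2 * j + 1) / 2)
    congr 1; omega
  · show reg.a j = reg.a ((2 * j + 1) / 2)
    congr 1; omega
  · funext fl
    show reg.mcrit j + reg.a j * (m fl + M) / reg.Zm j =
      reg.mcrit ((2 * j + 1) / 2) + reg.a ((2 * j + 1) / 2) * ((((2 * j + 1) % 2 : ℕ) : ℝ) * M) / reg.Zm ((2 * j + 1) / 2) +
        reg.a ((2 * j + 1) / 2) * m fl / reg.Zm ((2 * j + 1) / 2)
    have h1 : (2 * j + 1) / 2 = j := by omega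
    have h2 : (2 * j + 1) % 2 = 1 := by omega
    rw [h1, h2]; push_cast; ring

end Interleave

/-! ## §2 Keep-`reg` completion over `Hyp` forces mass-blind continuum data -/

/-- **Keep-`reg` completion forces MASS-BLIND continuum data.**  If every `Hyp`-witness carries the matrix `Body` of
`QCDOf` along ITSELF at every positive tuple (`hK`, the keep-`reg` form of the crux), then every `Hyp`-witness `reg` with
mass-independent fractional-moment exponents has, for every `M ≥ 0` and positive `m`, ONE OS datum `T` (non-trivial
non-Gaussian glue, flavour-changing pseudoscalars non-trivial) and ONE rate `Δ > 0` (`T.HasMassGap Δ`) that is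
`IsQCDAlong`-QCD along `reg` at the masses `m` AND at `m + M·1`, lattice gap `Δ` at both: apply `hK` to the interleaving
(`interleave_hyp`) and read the even / odd steps of its full-sequence limit (`isQCDAlong_along`, `latticeGap_along`).  No
honest witness is mass-blind — hence every completion of the typed crux must subsequence, where the `∃ᶠ` pin is no longer
inherited (stub E*). -/
theorem massBlind_of_sameRegCompletion
    (hK : ∀ reg : QCDRegularisation Nf, Hyp Nf reg → ∀ m : Fin Nf → ℝ, (∀ f, 0 < m f) → Body Nf reg m)
    (reg : QCDRegularisation Nf) (hH : Hyp Nf reg) {s₂ s₃ : ℝ} (hs₂ : 0 < s₂ ∧ s₂ < 1) (hs₃ : 0 < s₃ ∧ s₃ < 1)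
    (hU₂ : ∀ m : Fin Nf → ℝ, (∀ f, 0 < m f) → ∃ δ C : ℝ, 0 < δ ∧ ∀ᶠ k in atTop, ∀ S : ℕ, reg.L k ≤ S → ∀ (f : Fin Nf) (v : Literature.Probability.LatticeModels.Site 4), v ∈ box 4 S → (∫ U : GaugeConfig 4 (2 * S + 1) (Matrix.specialUnitaryGroup (Fin 3) ℂ), ‖(diracMatrix U fun fl => reg.mcrit k + reg.a k * m fl / reg.Zm k).det‖ * (∑ a : Fin 3, ∑ i : Fin 4, ∑ b : Fin 3, ∑ j : Fin 4, ‖(diracMatrix U fun fl => reg.mcrit k + reg.a k * m fl / reg.Zm k)⁻¹ (quarkEquiv (f, (Torus.proj (2 * S + 1) 0, a, i))) (quarkEquiv (f, (Torus.proj (2 * S + 1) (v), b, j)))‖) ^ s₂ ∂(wilsonMeasure (fundamentalRep (Fin 3)) (reg.β k))) / (∫ U : GaugeConfig 4 (2 * S + 1) (Matrix.specialUnitaryGroup (Fin 3) ℂ), ‖(diracMatrix U fun fl => reg.mcrit k + reg.a k * m fl / reg.Zm k).det‖ ∂(wilsonMeasure (fundamentalRep (Fin 3)) (reg.β k))) ≤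 C * Real.exp (-(δ * (reg.a k * ‖v‖))))
    (hU₃ : ∀ m : Fin Nf → ℝ, (∀ f, 0 < m f) → ∃ c₀ C₁ p : ℝ, 0 < c₀ ∧ ∀ᶠ k in atTop, ∀ S : ℕ, reg.L k ≤ S → ∀ (f : Fin Nf) (n : ℕ), n ≤ S → c₀ * Real.exp (-(C₁ * (reg.a k * n) + p * Real.log (n + 1))) ≤ (∫ U : GaugeConfig 4 (2 * S + 1) (Matrix.specialUnitaryGroup (Fin 3) ℂ), ‖(diracMatrix U fun fl => reg.mcrit k + reg.a k * m fl / reg.Zm k).det‖ * (∑ a : Fin 3, ∑ i : Fin 4, ∑ b : Fin 3, ∑ j : Fin 4, ‖(diracMatrix U fun fl => reg.mcrit k + reg.a k * m fl / reg.Zm k)⁻¹ (quarkEquiv (f, (Torus.proj (2 * S + 1) 0, a, i))) (quarkEquiv (f, (Torus.proj (2 * S + 1) (Pi.single 0 (n : ℤ)), b, j)))‖) ^ s₃ ∂(wilsonMeasure (fundamentalRep (Fin 3)) (reg.β k))) / (∫ U : GaugeConfig 4 (2 * S + 1) (Matrix.specialUnitaryGroup (Fin 3) ℂ), ‖(diracMatrix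 U fun fl => reg.mcrit k + reg.a k * m fl / reg.Zm k).det‖ ∂(wilsonMeasure (fundamentalRep (Fin 3)) (reg.β k))))
    {M : ℝ} (hM : 0 ≤ M) (m : Fin Nf → ℝ) (hm : ∀ f, 0 < m f) :
    ∃ (T : OSData (QCDField Nf) 4) (z₁ s₁ z₂ s₂ : QCDField Nf → ℕ → ℝ),
      IsQCDAlong (reg.scheme m z₁ s₁) T ∧ IsQCDAlong (reg.scheme (fun f => m f + M) z₂ s₂) T ∧
      T.IsNontrivial QCDField.glue ∧ T.IsNonGaussian QCDField.glue ∧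
      (∀ f g : Fin Nf, f ≠ g → T.IsNontrivial (QCDField.pseudoRe f g)) ∧
      ∃ Δ > 0, T.HasMassGap Δ ∧ (reg.scheme m 0 0).HasLatticeMassGap Δ ∧
        (reg.scheme (fun f => m f + M) 0 0).HasLatticeMassGap Δ := by
  obtain ⟨reg', hreg'⟩ : ∃ reg' : QCDRegularisation Nf, reg' =
      { a := fun k => reg.a (k / 2)
        a_pos := fun _ => reg.a_pos _
        tendsto_a := reg.tendsto_a.comp (Filter.map_div_atTop_eq_nat 2 two_pos).le
        β := fun k => reg.β (k / 2)
        L := fun k => reg.L (k / 2)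
        tendsto_L := reg.tendsto_L.comp (Filter.map_div_atTop_eq_nat 2 two_pos).le
        mcrit := fun k => reg.mcrit (k / 2) + reg.a (k / 2) * (((k % 2 : ℕ) : ℝ) * M) / reg.Zm (k / 2)
        Zm := fun k => reg.Zm (k / 2)
        Zm_pos := fun _ => reg.Zm_pos _ } := ⟨_, rfl⟩
  have ha' := il_a reg reg' M hreg'
  have hβ' := il_β reg reg' M hreg'
  have hL' := il_L reg reg' M hreg'
  have hZ' := il_Zm reg reg' M hreg'
  have hmc' := il_mcrit reg reg' M hreg'
  have hH' : Hyp Nf reg' := interleave_hyp reg reg' M hreg' hH hM hs₂ hs₃ hU₂ hU₃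
  obtain ⟨z, s, T, hQ, hN, hG, hP, Δ, hΔ, hT, hlat⟩ := hK reg' hH' m hm
  have hAS : (reg.scheme 0 0 0).HasAsymptoticScaling := hH.2.2.1
  refine ⟨T, fun s' j => z s' (2 * j), fun s' j => s s' (2 * j), fun s' j => z s' (2 * j + 1),
    fun s' j => s s' (2 * j + 1), ?_, ?_, hN, hG, hP, Δ, hΔ, hT, ?_, ?_⟩
  · exact isQCDAlong_along (fun j => 2 * j) (fun j => by omega) hQ hAS
      (interleave_L_eq reg reg' hL').1 (interleave_β_eq reg reg' hβ').1 (interleave_a_eq reg reg' ha').1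
      (interleave_mq_even reg reg' M ha' hZ' hmc' m z s _ _) (fun _ => rfl) (fun _ => rfl)
  · exact isQCDAlong_along (fun j => 2 * j + 1) (fun j => by omega) hQ hAS
      (interleave_L_eq reg reg' hL').2 (interleave_β_eq reg reg' hβ').2 (interleave_a_eq reg reg' ha').2
      (interleave_mq_odd reg reg' M ha' hZ' hmc' m z s _ _) (fun _ => rfl) (fun _ => rfl)
  · exact latticeGap_along (fun j => 2 * j) (fun j => by omega) hlat
      (interleave_L_eq reg reg' hL').1 (interleave_β_eq reg reg' hβ').1 (interleave_a_eq reg reg' ha').1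
      (interleave_mq_even reg reg' M ha' hZ' hmc' m z s 0 0)
  · exact latticeGap_along (fun j => 2 * j + 1) (fun j => by omega) hlat
      (interleave_L_eq reg reg' hL').2 (interleave_β_eq reg reg' hβ').2 (interleave_a_eq reg reg' ha').2
      (interleave_mq_odd reg reg' M ha' hZ' hmc' m z s 0 0)

/-- **Registered calibration sub-goal of crux stmt-QuantumFields-17498** (Π-form of `massBlind_of_sameRegCompletion`, exponents
and hypotheses curried): keep-`reg` completion over `Hyp` forces mass-blind continuum data along every `Hyp`-witness with
mass-independent fractional-moment exponents. -/
theorem keepRegCompletion_massBlind : ∀ (Nf : ℕ) (s₂ s₃ : ℝ), 0 < s₂ → s₂ < 1 → 0 < s₃ → s₃ < 1 → (∀ reg : QCDRegularisation Nf, Hyp Nf reg → ∀ m : Fin Nf → ℝ, (∀ f, 0 < m f) → Body Nf reg m) → ∀ reg : QCDRegularisation Nf, Hyp Nf reg → (∀ m : Fin Nf → ℝ, (∀ f, 0 < m f) → ∃ δ C : ℝ, 0 < δ ∧ ∀ᶠ k in atTop, ∀ S : ℕ, reg.L k ≤ S → ∀ (f : Fin Nf) (v : Literature.Probability.LatticeModels.Site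 4), v ∈ box 4 S → (∫ U : GaugeConfig 4 (2 * S + 1) (Matrix.specialUnitaryGroup (Fin 3) ℂ), ‖(diracMatrix U fun fl => reg.mcrit k + reg.a k * m fl / reg.Zm k).det‖ * (∑ a : Fin 3, ∑ i : Fin 4, ∑ b : Fin 3, ∑ j : Fin 4, ‖(diracMatrix U fun fl => reg.mcrit k + reg.a k * m fl / reg.Zm k)⁻¹ (quarkEquiv (f, (Torus.proj (2 * S + 1) 0, a, i))) (quarkEquiv (f, (Torus.proj (2 * S + 1) (v), b, j)))‖) ^ s₂ ∂(wilsonMeasure (fundamentalRep (Fin 3)) (reg.β k))) / (∫ U : GaugeConfig 4 (2 * S + 1) (Matrix.specialUnitaryGroup (Fin 3) ℂ), ‖(diracMatrix U fun fl => reg.mcrit k + reg.a k * m fl / reg.Zm k).det‖ ∂(wilsonMeasure (fundamentalRep (Fin 3)) (reg.β k))) ≤ C * Real.exp (-(δ * (reg.a k * ‖v‖)))) → (∀ m : Fin Nf → ℝ, (∀ f, 0 < m f) → ∃ c₀ C₁ p : ℝ, 0 < c₀ ∧ ∀ᶠ k in atTop, ∀ S : ℕ, reg.L k ≤ S → ∀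 (f : Fin Nf) (n : ℕ), n ≤ S → c₀ * Real.exp (-(C₁ * (reg.a k * n) + p * Real.log (n + 1))) ≤ (∫ U : GaugeConfig 4 (2 * S + 1) (Matrix.specialUnitaryGroup (Fin 3) ℂ), ‖(diracMatrix U fun fl => reg.mcrit k + reg.a k * m fl / reg.Zm k).det‖ * (∑ a : Fin 3, ∑ i : Fin 4, ∑ b : Fin 3, ∑ j : Fin 4, ‖(diracMatrix U fun fl => reg.mcrit k + reg.a k * m fl / reg.Zm k)⁻¹ (quarkEquiv (f, (Torus.proj (2 * S + 1) 0, a, i))) (quarkEquiv (f, (Torus.proj (2 * S + 1) (Pi.single 0 (n : ℤ)), b, j)))‖) ^ s₃ ∂(wilsonMeasure (fundamentalRep (Fin 3)) (reg.β k))) / (∫ U : GaugeConfig 4 (2 * S + 1) (Matrix.specialUnitaryGroup (Fin 3) ℂ), ‖(diracMatrix U fun fl => reg.mcrit k + reg.a k * m fl / reg.Zm k).det‖ ∂(wilsonMeasure (fundamentalRep (Fin 3)) (reg.β k)))) → ∀ M : ℝ, 0 ≤ M → ∀ m : Fin Nf → ℝ, (∀ f, 0 < m f) → ∃ (T : OSData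 (QCDField Nf) 4) (z₁ sh₁ z₂ sh₂ : QCDField Nf → ℕ → ℝ), IsQCDAlong (reg.scheme m z₁ sh₁) T ∧ IsQCDAlong (reg.scheme (fun f => m f + M) z₂ sh₂) T ∧ T.IsNontrivial QCDField.glue ∧ T.IsNonGaussian QCDField.glue ∧ (∀ f g : Fin Nf, f ≠ g → T.IsNontrivial (QCDField.pseudoRe f g)) ∧ ∃ Δ > 0, T.HasMassGap Δ ∧ (reg.scheme m 0 0).HasLatticeMassGap Δ ∧ (reg.scheme (fun f => m f + M) 0 0).HasLatticeMassGap Δ :=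
  fun _Nf _s₂ _s₃ h₁ h₂ h₃ h₄ hK reg hH hU₂ hU₃ _M hM m hm =>
    massBlind_of_sameRegCompletion hK reg hH ⟨h₁, h₂⟩ ⟨h₃, h₄⟩ hU₂ hU₃ hM m hm

/-- The other side of the coin (cf. Disproof `qcdOf_of_sameReg`): keep-`reg` completion WOULD close the crux in one line
(pin and mass scaling travel with `reg` by `rfl`) — mass-blindness is exactly the price of not subsequencing. -/
theorem chiralGluonicCompletion_of_sameRegCompletion
    (hK : ∀ Nf : ℕ, Nf = 2 ∨ Nf = 3 → ∀ reg : QCDRegularisation Nf, Hyp Nf reg →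
      ∀ m : Fin Nf → ℝ, (∀ f, 0 < m f) → Body Nf reg m) :
    Summit.QuantumFields.QCD.Theses.WilsonMobilityGap.ChiralGluonicCompletion := by
  rw [← crux_eq_wilsonMobilityGap, crux_iff]
  rintro Nf hNf ⟨reg, hH⟩
  exact (qcdOf_iff_body Nf).2 ⟨reg, hH.1, hH.2.1, hK Nf hNf reg hH⟩

end Summit.QuantumFields.QCD.Theorems.StronglyChiralSubsequence

end
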